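import Literature.AlgebraicGeometry.Motives.AbelianVarietyFrobeniusGroupIdempotentRelations
import HarnessLib

/-!
# Kani–Rosen relations for the non-abelian groups of order `pq`, `G_{p,q} = ⟨a, b : a^q = b^p = 1, bab⁻¹ = a^r⟩ ≅ C_q ⋊ C_p`,
# BY PRESENTATION: `X × B_G^p ∼ B_a × B_b^p`, "`JS ∼ JX × JY^p`" (Reyes-Carocca), `P(X ↠ X/⟨a⟩) ∼ B_b^p` — ALGEBRAIC
# carrier, over an arbitrary (resp. perfect) field

Layer A1/A2 of the Hodge foundations lane (`lit-hodgefound`, row A1-20⁺ · A2, RULING 23) on the ALGEBRAIC carrier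
`AbelianVariety K` of `Motives/AbelianVariety`; sequel of `Motives/AbelianVarietyFrobeniusGroupIdempotentRelations`
(Kani–Rosen relations for Frobenius groups `N ⋊ H` in GROUP FORM; CONSUMED by name: `finrank_hom_frobeniusGroup`,
`isIsogenous_image_sub_norm_frobeniusGroup`, and through it `Motives/AbelianVarietyIdempotentRelations`,
`Motives/AbelianVarietyIsogenyCancellation`), in the style of the presentation files
`Motives/AbelianVarietyDihedralIdempotentRelations` (`D_n`: `τστ⁻¹ = σ⁻¹`) and
`Motives/AbelianVarietyTetrahedralIdempotentRelations` (`A_4`).  Here: the unique non-abelian group of order `pq`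
(`p`, `q` primes, `p ∣ q − 1`) GIVEN BY ITS PRESENTATION inside an arbitrary finite group `G` of order `pq` —
elements `a`, `b` with `|a| = q`, `|b| = p`, `bab⁻¹ = a^r`, `r` of multiplicative order `p` modulo `q`
(`(r : ZMod q)^p = 1`, `(r : ZMod q) ≠ 1`).  §1 proves from the presentation that `G = ⟨a⟩⟨b⟩` with
`⟨a⟩ ∩ ⟨b⟩ = 1` (Mathlib's `Subgroup.isComplement'_of_coprime`), `⟨a⟩ ◁ G` and Isaacs's Frobenius condition (b)
`C_⟨b⟩(n) = 1` for `1 ≠ n ∈ ⟨a⟩` (`b^j a^i b^{−j} = a^{i r^j}`; `a^{i r^j} = a^i` with `q ∤ i` forces `r^j ≡ 1 (mod q)`,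
i.e. `p ∣ j`); §§2–3 are then the instances `N = ⟨a⟩`, `H = ⟨b⟩` of the Frobenius-group relations.  Everything here
is PROVED; the file introduces NO definition and NO named fact (net Literature debt 0).

## Source, verbatim

S. Reyes-Carocca, *On `pq`-fold regular covers of the projective line*, Rev. R. Acad. Cienc. Exactas Fís. Nat. Ser. A
Mat. RACSAM **115** (2021), arXiv 2006.15499, held text `paper:arxiv-2006.15499`.  §1 (arXiv p. 3): "Let `p` and `q` be
odd primes such that `p` divides `q−1` and let `r` be a primitive `p`-th root of unity in the field of `q` elements.
Throughout the article the unique non-abelian group of order `pq` will be denote by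
`G_{p,q} := ⟨a, b : a^q = b^p = 1, bab⁻¹ = a^r⟩ ≅ C_q ⋊ C_p`."; "**Theorem 1.** Let `n, m ≥ 0` be integers such that
`n + m ≥ 3`. There exists a compact Riemann surface `S` of genus greater than one endowed with a group of automorphisms
isomorphic to `G_{p,q}` acting on it with signature `s_{n,m} := (0; p, …ⁿ, p, q, …ᵐ, q)` if and only if `n ≥ 2`. In
this case, the genus of `S` is `g = 1 − pq + nq((p−1)/2) + mp((q−1)/2)`."; "We recall the obvious fact that `G_{p,q}`
has a unique normal subgroup `N` of order `q`, and `q` pairwise conjugate subgroups of order `p`; let `H` be one of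
them. […] we consider the regular covering maps `S → X := S/N` and `S → Y := S/H` […] the genera of `X` and `Y` are
`g_X = (p−1)/2 (n−2)` and `g_Y = (q−1)/2 (m−2) + (p−1)/2 (q−1)/p n`."  (arXiv p. 5): "**Theorem 6.** Let `S` be a compact
Riemann surface lying in the family `𝒞_{n,m}`. Then the Jacobian variety `JS` of `S` decomposes, up to isogeny, as the
product `JS ∼ B_1 × B_2^p` where `B_1` and `B_2` are abelian subvarieties of `JS` of dimension `(p−1)/2 (n−2)` and
`(q−1)/2 (m−2) + (p−1)/2 (q−1)/p n`."; "**Theorem 7.** Let `S` be a compact Riemann surface lying in the family `𝒞_{n,m}`.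
With the notations of Theorem 6, there exist isogenies `JX → B_1` and `JY → B_2` and, in particular, `JS` is isogenous
to the product of Jacobians of quotients of `S`, `JS ∼ JX × JY^p`".  §8 (arXiv p. 14): "the group algebra decomposition
of `JS` with respect to `G_{p,q}` is `JS ∼ B_0 × B_1 × B_2^p` where the factor `B_l` is associated to the representation
`W_l` […]. Note that `B_0` is isogenous to the Jacobian variety of `S/G_{p,q}`."; "Following [cr], if `K` is a subgroup
of `G_{p,q}` then `J(S/K) ∼ B_1^{n_1^K} × B_2^{n_2^K}` where `n_1^K` and `n_2^K` are the dimension of the vector subspaces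
of `χ_1` and `ψ_1` fixed under the action of `K`. Now, if we consider (…) with `K = N` and `K = H` we obtain
`JX = J(S/N) ∼ B_1^1 × B_2^0` and `JY = J(S/H) ∼ B_1^0 × B_2^1` respectively, and the result follows."

With `B_0 ∼ J(S/G)` restored (no assumption on `S/G`) these displays read `JS × B_0^p ∼ JX × JY^p`, i.e.
`J_S × J_{S/G}^p ∼ J_{S/N} × J_{S/H}^p` — Kani–Rosen's Theorem B ([cite: KaniRosen1989, Thm. B], "`J_C^{t−1} × J_{C/G}^g ∼
J_{C/H_1}^{h_1} × ⋯ × J_{C/H_t}^{h_t}`") for the partition of `G_{p,q}` into `N` and the `q` conjugates of `H`, divided by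
`q`; this is the form proved here for an arbitrary abelian variety with a `G_{p,q}`-action.  I. M. Isaacs, *Character
Theory of Finite Groups* (1976), Problem 7.1 (p. 121): "(b) `C_H(n) = 1` for all `1 ≠ n ∈ N`" ⇔ "(f) `H` is a
Frobenius complement in `G`" — the hypothesis of the Frobenius file, verified here from the presentation.

## Dictionary and what is proved (namespace `Literature.AlgebraicGeometry.Motives.AbelianVariety`)

A finite group `G` with `Fintype.card G = p * q` (`hp : p.Prime`, `hq : q.Prime`), `a b : G` with `orderOf a = q`,
`orderOf b = p`, `hab : b * a * b⁻¹ = a ^ r` (`r : ℕ`), `hr : (r : ZMod q) ^ p = 1`, `hr1 : (r : ZMod q) ≠ 1` (then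
`p ≠ q` automatically, `p ∣ q − 1`); an action `ρ : G →* End X` on an abelian variety `X` over a field `K`, norm
endomorphisms `End.of N_G = Σ_g ρ g`, `End.of N_a = Σ_{h : zpowers a} ρ h`, `End.of N_b = Σ_{h : zpowers b} ρ h` (any
`Fintype` structures on `⟨a⟩`, `⟨b⟩`), `B_S := image N_S`.
* §1 (group theory, from the presentation): `pow_mul_pow_mul_inv` (`b^j a^i b^{−j} = a^{i r^j}`, private),
  **`isComplement'_zpowers_of_card_eq_mul`** (`G = ⟨a⟩⟨b⟩`, `⟨a⟩ ∩ ⟨b⟩ = 1`, for `p ≠ q` primes),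
  **`normal_zpowers_of_card_eq_mul`** (`⟨a⟩ ◁ G`), **`comm_eq_one_zpowers`** (Isaacs (b): `C_⟨b⟩(n) = 1` for
  `1 ≠ n ∈ ⟨a⟩`).
* §2 (any field) **`finrank_hom_metacyclic`**: `rk Hom(X, B) + p · rk Hom(B_G, B) = rk Hom(B_a, B) + p · rk Hom(B_b, B)`.
* §3 (perfect field) **`isIsogenous_metacyclic`** (`X ⊞ B_G^p ∼ B_a ⊞ B_b^p`), `dim_metacyclic`
  (`dim X + p dim B_G = dim B_a + p dim B_b`, the genus count `g = g_X + p g_Y` of Thm. 1/Thm. 6),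
  **`isIsogenous_metacyclic_of_dim_eq_zero`** (`B_G = 0 ⇒ X ∼ B_a ⊞ B_b^p` — Thm. 7 "`JS ∼ JX × JY^p`"),
  **`isIsogenous_image_sub_norm_metacyclic`** (`Im(q·1 − N_a) ⊞ B_G^p ∼ B_b^p`),
  `isIsogenous_image_sub_norm_metacyclic_of_dim_eq_zero` (`P(X ↠ X/⟨a⟩) ∼ B_b^p` — Thm. 6's factor `B_2^p`),
  `dim_image_sub_norm_metacyclic`.

Scope (stated, not hidden). (1) As in the companion files `J(S/K)` is REPLACED by `ε_K(X) = Im N_K`; the quotient-curve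
reading "`JR → JS` whose image is an abelian subvariety of `JS` of dimension `γ` which is isogenous to `JR`" is not
asserted (`-- TODO(general form)` of `IdempotentRelations`).  (2) `p = 2` is allowed (`r ≡ −1`: the dihedral group
`D_q`, `q` an odd prime — `isIsogenous_dihedral_odd` of the dihedral file covers all odd `n`, by a different
presentation; nothing is restated).  (3) The existence statements (Thm. 1: signatures `s_{n,m}`, the families
`𝒞_{n,m}`, algebraic models, Thms. 2–5) and the dimensions of `B_1`, `B_2` (Riemann–Hurwitz) are statements about
curves and are not formalised.  (4) Hom counts over ANY field; isogenies and dimensions over a PERFECT field.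

## References

* [ReyesCarocca2020] S. Reyes-Carocca, *On `pq`-fold regular covers of the projective line*, RACSAM 115 (2021),
  doi 10.1007/s13398-020-00965-6, arXiv:2006.15499 — §1 (p. 3), Thm. 1, Thm. 6, Thm. 7 (p. 5), §8 (p. 14).
* [Isaacs1976] I. M. Isaacs, *Character Theory of Finite Groups*, Academic Press 1976, Problem 7.1 (p. 121).
* [KaniRosen1989] E. Kani, M. Rosen, *Idempotent relations and factors of Jacobians*, Math. Ann. 284 (1989), Thm. B.
-/

noncomputable section

universe u

open CategoryTheory CategoryTheory.Limits AlgebraicGeometry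

namespace Literature.AlgebraicGeometry.Motives

namespace AbelianVariety

variable {K : Type u} [Field K]

/-! ## §1 The non-abelian groups of order `pq` by presentation: `a^q = b^p = 1`, `bab⁻¹ = a^r`, `r` of order `p` mod `q` -/

section MetacyclicGroup

variable {G : Type} [Group G] {a b : G} {p q r : ℕ}

/-- `b^j a^i b^{-j} = a^{i r^j}` from `bab⁻¹ = a^r`. [cite: ReyesCarocca2020, §1 (presentation of `G_{p,q}`, p. 3)] -/
private theorem pow_mul_pow_mul_inv (hab : b * a * b⁻¹ = a ^ r) (j i : ℕ) :
    b ^ j * a ^ i * (b ^ j)⁻¹ = a ^ (i * r ^ j) := by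
  induction j generalizing i with
  | zero => simp
  | succ j ih =>
    rw [pow_succ, mul_inv_rev, show b ^ j * b * a ^ i * (b⁻¹ * (b ^ j)⁻¹) =
      b ^ j * (b * a ^ i * b⁻¹) * (b ^ j)⁻¹ by group, ← conj_pow, hab, ← pow_mul, ih]
    congr 1
    ring

/-- Elements of `⟨x⟩` are `x^j` with `j < |x|` (finite order). [folklore] -/
private theorem exists_pow_eq_of_mem_zpowers [Finite G] {x y : G} (hy : y ∈ Subgroup.zpowers x) :
    ∃ j < orderOf x, x ^ j = y := by
  classical
  rw [mem_zpowers_iff_mem_range_orderOf, Finset.mem_image] at hy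
  obtain ⟨j, hj, rfl⟩ := hy
  exact ⟨j, Finset.mem_range.1 hj, rfl⟩

/-- `p ≠ q`: a primitive `p`-th root of unity `r` mod `q` with `r ≠ 1` forces `p ≠ q` (`r^q = r` in `𝔽_q`).
[cite: ReyesCarocca2020, §1 ("`p` divides `q − 1`", p. 3)] -/
private theorem ne_of_pow_eq_one (hq : q.Prime) (hr : (r : ZMod q) ^ p = 1) (hr1 : (r : ZMod q) ≠ 1) : p ≠ q := by
  rintro rfl
  haveI : Fact p.Prime := ⟨hq⟩
  exact hr1 (by rwa [ZMod.pow_card] at hr)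

/-- The multiplicative order of `r` mod `q` is `p`. [cite: ReyesCarocca2020, §1 ("`r` a primitive `p`-th root of unity in the field of `q` elements", p. 3)] -/
private theorem orderOf_cast_eq (hp : p.Prime) (hr : (r : ZMod q) ^ p = 1) (hr1 : (r : ZMod q) ≠ 1) :
    orderOf (r : ZMod q) = p :=
  haveI : Fact p.Prime := ⟨hp⟩
  orderOf_eq_prime hr hr1

variable [Fintype G]

/-- **`G = ⟨a⟩⟨b⟩`, `⟨a⟩ ∩ ⟨b⟩ = 1`** for `|G| = pq`, `|a| = q`, `|b| = p`, `p ≠ q` primes (subgroups of coprime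
orders `q`, `p` with `qp = |G|` are complements). [cite: ReyesCarocca2020, §1 (p. 3)] -/
theorem isComplement'_zpowers_of_card_eq_mul (hp : p.Prime) (hq : q.Prime) (hpq : p ≠ q)
    (hG : Fintype.card G = p * q) (ha : orderOf a = q) (hb : orderOf b = p) :
    Subgroup.IsComplement' (Subgroup.zpowers a) (Subgroup.zpowers b) := by
  refine Subgroup.isComplement'_of_coprime ?_ ?_
  · rw [Nat.card_zpowers, Nat.card_zpowers, ha, hb, Nat.card_eq_fintype_card, hG, mul_comm]
  · rw [Nat.card_zpowers, Nat.card_zpowers, ha, hb]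
    exact (Nat.coprime_primes hq hp).2 (Ne.symm hpq)

/-- **`⟨a⟩ ◁ G`**: every `g = a^i b^j` conjugates `a^k` to `a^{k r^j}`. [cite: ReyesCarocca2020, §1 ("`G_{p,q}` has a unique normal subgroup `N` of order `q`", p. 3)] -/
theorem normal_zpowers_of_card_eq_mul (hp : p.Prime) (hq : q.Prime) (hpq : p ≠ q) (hG : Fintype.card G = p * q)
    (ha : orderOf a = q) (hb : orderOf b = p) (hab : b * a * b⁻¹ = a ^ r) : (Subgroup.zpowers a).Normal := by
  refine ⟨fun n hn g ↦ ?_⟩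
  have hc := isComplement'_zpowers_of_card_eq_mul hp hq hpq hG ha hb
  obtain ⟨⟨x, y⟩, hxy, -⟩ := Subgroup.IsComplement.existsUnique hc g
  obtain ⟨k, -, rfl⟩ := exists_pow_eq_of_mem_zpowers hn
  obtain ⟨i, -, hi⟩ := exists_pow_eq_of_mem_zpowers x.2
  obtain ⟨j, -, hj⟩ := exists_pow_eq_of_mem_zpowers y.2
  have hg : g = a ^ i * b ^ j := by rw [← hxy, ← hi, ← hj]
  rw [hg, show a ^ i * b ^ j * a ^ k * (a ^ i * b ^ j)⁻¹ = a ^ i * (b ^ j * a ^ k * (b ^ j)⁻¹) * (a ^ i)⁻¹ by group,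
    pow_mul_pow_mul_inv hab, show a ^ i * a ^ (k * r ^ j) * (a ^ i)⁻¹ = a ^ (k * r ^ j) by
      rw [← pow_add, add_comm, pow_add, mul_inv_cancel_right]]
  exact Subgroup.npow_mem_zpowers a _

/-- **`C_{⟨b⟩}(n) = 1` for `1 ≠ n ∈ ⟨a⟩`** (Isaacs's condition (b): `G_{p,q}` is a Frobenius group with kernel `⟨a⟩` and
complement `⟨b⟩`): `b^j` commutes with `a^i ≠ 1` iff `a^{i r^j} = a^i` iff `r^j ≡ 1 (mod q)` iff `p ∣ j`.
[cite: ReyesCarocca2020, §1 ("`q` pairwise conjugate subgroups of order `p`", p. 3)] [cite: Isaacs1976, Problem 7.1 (b) (p. 121)] -/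
theorem comm_eq_one_zpowers (hp : p.Prime) (hq : q.Prime) (ha : orderOf a = q) (hb : orderOf b = p)
    (hab : b * a * b⁻¹ = a ^ r) (hr : (r : ZMod q) ^ p = 1) (hr1 : (r : ZMod q) ≠ 1) :
    ∀ n ∈ Subgroup.zpowers a, n ≠ 1 → ∀ h ∈ Subgroup.zpowers b, h * n = n * h → h = 1 := by
  intro n hn hn1 h hh hcomm
  obtain ⟨i, hi, rfl⟩ := exists_pow_eq_of_mem_zpowers hn
  obtain ⟨j, hj, rfl⟩ := exists_pow_eq_of_mem_zpowers hh
  rw [ha] at hi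
  rw [hb] at hj
  have hi0 : i ≠ 0 := fun h0 ↦ hn1 (by rw [h0, pow_zero])
  -- `a^{i r^j} = a^i`
  have h1 : a ^ (i * r ^ j) = a ^ i := by
    rw [← pow_mul_pow_mul_inv hab j i, hcomm, mul_inv_cancel_right]
  rw [pow_eq_pow_iff_modEq, ha] at h1
  have h2 : ((i : ZMod q) * ((r : ZMod q) ^ j - 1)) = 0 := by
    have := (ZMod.natCast_eq_natCast_iff _ _ _).2 h1
    push_cast at this
    linear_combination this
  haveI : Fact q.Prime := ⟨hq⟩
  have hi' : (i : ZMod q) ≠ 0 := by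
    rw [Ne, ZMod.natCast_eq_zero_iff]
    exact fun hdvd ↦ hi0 (Nat.eq_zero_of_dvd_of_lt hdvd hi)
  have h3 : (r : ZMod q) ^ j = 1 := by
    rcases mul_eq_zero.1 h2 with h | h
    · exact absurd h hi'
    · exact sub_eq_zero.1 h
  have h4 : p ∣ j := by
    rw [← orderOf_cast_eq hp hr hr1]
    exact orderOf_dvd_of_pow_eq_one h3
  have hj0 : j = 0 := Nat.eq_zero_of_dvd_of_lt h4 hj
  rw [hj0, pow_zero]

end MetacyclicGroup

/-! ## §2 The Kani–Rosen relation of `G_{p,q} = C_q ⋊ C_p`: Hom counts (any field) -/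

section MetacyclicCounts

variable {X : AbelianVariety K} {G : Type} [Group G] [Fintype G] (ρ : G →* End X) {a b : G} {p q r : ℕ}
  [Fintype (Subgroup.zpowers a)] [Fintype (Subgroup.zpowers b)] {N NA NB : X ⟶ X}

omit [Fintype G] in
/-- `|⟨x⟩| = |x|` for the user's `Fintype` structure on `⟨x⟩`. [folklore] -/
private theorem card_zpowers_eq' {x : G} [Fintype (Subgroup.zpowers x)] :
    Fintype.card (Subgroup.zpowers x) = orderOf x := by
  rw [← Nat.card_eq_fintype_card, Nat.card_zpowers]

/-- **The Hom counts for the non-abelian group of order `pq`.**  Let a finite group `G` of order `pq` (`p`, `q` primes)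
act on an abelian variety `X` over any field, with `a, b ∈ G` of orders `q`, `p` and `bab⁻¹ = a^r` for an `r` of
multiplicative order `p` modulo `q` ("`G_{p,q} := ⟨a, b : a^q = b^p = 1, bab⁻¹ = a^r⟩ ≅ C_q ⋊ C_p`", "`r` a primitive
`p`-th root of unity in the field of `q` elements"; so `G = ⟨a⟩ ⋊ ⟨b⟩` is a Frobenius group with kernel `N = ⟨a⟩` — "a
unique normal subgroup `N` of order `q`" — and complement `H = ⟨b⟩` — "`q` pairwise conjugate subgroups of order `p`").
Then for every abelian variety `B`: `rk Hom(X, B) + p · rk Hom(B_G, B) = rk Hom(B_a, B) + p · rk Hom(B_b, B)`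
(`B_G = Im N_G`, `B_a = Im N_⟨a⟩`, `B_b = Im N_⟨b⟩`) — the instance `N = ⟨a⟩`, `H = ⟨b⟩` of `finrank_hom_frobeniusGroup`;
for Jacobians "`J(S/K) ∼ B_1^{n_1^K} × B_2^{n_2^K}`", "`JX = J(S/N) ∼ B_1^1 × B_2^0` and `JY = J(S/H) ∼ B_1^0 × B_2^1`" with
"`JS ∼ B_0 × B_1 × B_2^p`", `B_0 ∼ J(S/G)`. (`p = 2`, `r ≡ −1`: the dihedral group `D_q`, `finrank_hom_dihedral_odd` of
`Motives/AbelianVarietyDihedralIdempotentRelations`, not restated.)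
[cite: ReyesCarocca2020, §1 (p. 3), Thm. 6, Thm. 7 (p. 5), §8 (p. 14)] [cite: Isaacs1976, Problem 7.1 (p. 121)] [cite: KaniRosen1989, Thm. B] -/
theorem finrank_hom_metacyclic (hp : p.Prime) (hq : q.Prime) (hG : Fintype.card G = p * q) (ha : orderOf a = q)
    (hb : orderOf b = p) (hab : b * a * b⁻¹ = a ^ r) (hr : (r : ZMod q) ^ p = 1) (hr1 : (r : ZMod q) ≠ 1)
    (hN : End.of N = ∑ g, ρ g) (hNA : End.of NA = ∑ h : Subgroup.zpowers a, ρ h)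
    (hNB : End.of NB = ∑ h : Subgroup.zpowers b, ρ h) (B : AbelianVariety K) :
    Module.finrank ℤ (X ⟶ B) + p * Module.finrank ℤ (image N ⟶ B) =
      Module.finrank ℤ (image NA ⟶ B) + p * Module.finrank ℤ (image NB ⟶ B) := by
  have hpq := ne_of_pow_eq_one hq hr hr1
  haveI := normal_zpowers_of_card_eq_mul hp hq hpq hG ha hb hab
  have h := finrank_hom_frobeniusGroup ρ (isComplement'_zpowers_of_card_eq_mul hp hq hpq hG ha hb)
    (comm_eq_one_zpowers hp hq ha hb hab hr hr1) hN hNA hNB B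
  rwa [card_zpowers_eq', hb] at h

end MetacyclicCounts

/-! ## §3 The isogenies over a perfect field: `X × B_G^p ∼ B_a × B_b^p`, "`JS ∼ JX × JY^p`", `P(X ↠ X/⟨a⟩) ∼ B_b^p` -/

section MetacyclicIsogeny

variable [PerfectField K] {X : AbelianVariety K} {G : Type} [Group G] [Fintype G] (ρ : G →* End X) {a b : G}
  {p q r : ℕ} [Fintype (Subgroup.zpowers a)] [Fintype (Subgroup.zpowers b)] {N NA NB : X ⟶ X}

/-- **`X × B_G^p ∼ B_a × B_b^p`** over a perfect field, for an action of the non-abelian group of order `pq`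
(`|G| = pq`, `|a| = q`, `|b| = p`, `bab⁻¹ = a^r`, `r` of order `p` mod `q`): Kani–Rosen's Theorem B for the partition
of `G_{p,q}` into `⟨a⟩` and the `q` conjugates of `⟨b⟩`, divided by `q`; for a curve `S` with `S/G ≅ ℙ¹`:
"`JS ∼ JX × JY^p`" (`X = S/N`, `Y = S/H`). [cite: ReyesCarocca2020, Thm. 7 (p. 5)] [cite: KaniRosen1989, Thm. B] -/
theorem isIsogenous_metacyclic (hp : p.Prime) (hq : q.Prime) (hG : Fintype.card G = p * q) (ha : orderOf a = q)
    (hb : orderOf b = p) (hab : b * a * b⁻¹ = a ^ r) (hr : (r : ZMod q) ^ p = 1) (hr1 : (r : ZMod q) ≠ 1)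
    (hN : End.of N = ∑ g, ρ g) (hNA : End.of NA = ∑ h : Subgroup.zpowers a, ρ h)
    (hNB : End.of NB = ∑ h : Subgroup.zpowers b, ρ h) :
    IsIsogenous (X ⊞ ⨁ fun _ : Fin p ↦ image N) (image NA ⊞ ⨁ fun _ : Fin p ↦ image NB) := by
  refine isIsogenous_iff_forall_finrank_hom_eq'.2 fun B ↦ ?_
  rw [finrank_hom_biprod, finrank_hom_biprod, finrank_hom_biproduct_const, finrank_hom_biproduct_const,
    Fintype.card_fin]
  exact finrank_hom_metacyclic ρ hp hq hG ha hb hab hr hr1 hN hNA hNB B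

/-- **Dimensions: `dim X + p · dim B_G = dim B_a + p · dim B_b`** (perfect field) — for `S ∈ 𝒞_{n,m}` (`S/G ≅ ℙ¹`) the
genus count `g = g_X + p g_Y`: "`g = 1 − pq + nq (p−1)/2 + mp (q−1)/2`", "`g_X = (p−1)/2 (n−2)` and
`g_Y = (q−1)/2 (m−2) + (p−1)/2 (q−1)/p n`". [cite: ReyesCarocca2020, Thm. 1 and §1 (pp. 3–4), Thm. 6] [cite: KaniRosen1989, Thm. B] -/
theorem dim_metacyclic (hp : p.Prime) (hq : q.Prime) (hG : Fintype.card G = p * q) (ha : orderOf a = q)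
    (hb : orderOf b = p) (hab : b * a * b⁻¹ = a ^ r) (hr : (r : ZMod q) ^ p = 1) (hr1 : (r : ZMod q) ≠ 1)
    (hN : End.of N = ∑ g, ρ g) (hNA : End.of NA = ∑ h : Subgroup.zpowers a, ρ h)
    (hNB : End.of NB = ∑ h : Subgroup.zpowers b, ρ h) :
    X.dim + p * (image N).dim = (image NA).dim + p * (image NB).dim := by
  have e := (isIsogenous_metacyclic ρ hp hq hG ha hb hab hr hr1 hN hNA hNB).dim_eq
  simp only [dim_biprod, dim_biproduct_const, Fintype.card_fin] at e
  exact e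

/-- **`B_G = 0` (`S/G ≅ ℙ¹`): `X ∼ B_a × B_b^p`** — "**Theorem 7.** […] `JS` is isogenous to the product of Jacobians
of quotients of `S`, `JS ∼ JX × JY^p`" (`X = S/N`, `Y = S/H`; the quotient-curve reading `ε_H(JS) ∼ J(S/H)`,
"the induced homomorphism `JR → JS` whose image is […] isogenous to `JR`", is not asserted here).
[cite: ReyesCarocca2020, Thm. 7 (p. 5) and §8 (p. 14)] [cite: KaniRosen1989, Thm. B] -/
theorem isIsogenous_metacyclic_of_dim_eq_zero (hp : p.Prime) (hq : q.Prime) (hG : Fintype.card G = p * q)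
    (ha : orderOf a = q) (hb : orderOf b = p) (hab : b * a * b⁻¹ = a ^ r) (hr : (r : ZMod q) ^ p = 1)
    (hr1 : (r : ZMod q) ≠ 1) (hN : End.of N = ∑ g, ρ g) (hNA : End.of NA = ∑ h : Subgroup.zpowers a, ρ h)
    (hNB : End.of NB = ∑ h : Subgroup.zpowers b, ρ h) (h0 : (image N).dim = 0) :
    IsIsogenous X (image NA ⊞ ⨁ fun _ : Fin p ↦ image NB) := by
  have h := isIsogenous_metacyclic ρ hp hq hG ha hb hab hr hr1 hN hNA hNB
  have hP : (⨁ fun _ : Fin p ↦ image N).dim = 0 := by rw [dim_biproduct_const, h0, mul_zero]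
  exact (isIsogenous_of_isIsogenous_biprod_of_dim_eq_zero h.symm' hP).symm'

/-- **The Prym form: `P(X ↠ X/⟨a⟩) × B_G^p ∼ B_b^p`**, `P = Im(q·1 − N_⟨a⟩) = X^{1 − ε_⟨a⟩}` (perfect field) — the
factor "`B_2^p`" of "`JS ∼ B_0 × B_1 × B_2^p`" with "`JX ∼ B_1`", "`JY ∼ B_2`", `B_0 ∼ J(S/G)`.
[cite: ReyesCarocca2020, Thm. 6 (p. 5) and §8 (p. 14)] [cite: KaniRosen1989, Thm. B] -/
theorem isIsogenous_image_sub_norm_metacyclic (hp : p.Prime) (hq : q.Prime) (hG : Fintype.card G = p * q)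
    (ha : orderOf a = q) (hb : orderOf b = p) (hab : b * a * b⁻¹ = a ^ r) (hr : (r : ZMod q) ^ p = 1)
    (hr1 : (r : ZMod q) ≠ 1) (hN : End.of N = ∑ g, ρ g) (hNA : End.of NA = ∑ h : Subgroup.zpowers a, ρ h)
    (hNB : End.of NB = ∑ h : Subgroup.zpowers b, ρ h) :
    IsIsogenous (image (q • 𝟙 X - NA) ⊞ ⨁ fun _ : Fin p ↦ image N) (⨁ fun _ : Fin p ↦ image NB) := by
  have hpq := ne_of_pow_eq_one hq hr hr1
  haveI := normal_zpowers_of_card_eq_mul hp hq hpq hG ha hb hab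
  have h := isIsogenous_image_sub_norm_frobeniusGroup ρ (isComplement'_zpowers_of_card_eq_mul hp hq hpq hG ha hb)
    (comm_eq_one_zpowers hp hq ha hb hab hr hr1) hN hNA hNB
  rwa [card_zpowers_eq', card_zpowers_eq', ha, hb] at h

/-- **`B_G = 0`: `P(X ↠ X/⟨a⟩) ∼ B_b^p`** ("`JS ∼ B_1 × B_2^p`" with "`JX → B_1` and `JY → B_2`" isogenies: the Prym
variety of `S → X = S/N` is isogenous to `JY^p`). [cite: ReyesCarocca2020, Thm. 6 and Thm. 7 (p. 5)] [cite: KaniRosen1989, Thm. B] -/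
theorem isIsogenous_image_sub_norm_metacyclic_of_dim_eq_zero (hp : p.Prime) (hq : q.Prime)
    (hG : Fintype.card G = p * q) (ha : orderOf a = q) (hb : orderOf b = p) (hab : b * a * b⁻¹ = a ^ r)
    (hr : (r : ZMod q) ^ p = 1) (hr1 : (r : ZMod q) ≠ 1) (hN : End.of N = ∑ g, ρ g)
    (hNA : End.of NA = ∑ h : Subgroup.zpowers a, ρ h) (hNB : End.of NB = ∑ h : Subgroup.zpowers b, ρ h)
    (h0 : (image N).dim = 0) :
    IsIsogenous (image (q • 𝟙 X - NA)) (⨁ fun _ : Fin p ↦ image NB) := by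
  have h := isIsogenous_image_sub_norm_metacyclic ρ hp hq hG ha hb hab hr hr1 hN hNA hNB
  have hP : (⨁ fun _ : Fin p ↦ image N).dim = 0 := by rw [dim_biproduct_const, h0, mul_zero]
  exact (isIsogenous_of_isIsogenous_biprod_of_dim_eq_zero h.symm' hP).symm'

/-- **Dimensions in the Prym form: `dim P(X ↠ X/⟨a⟩) + p · dim B_G = p · dim B_b`** ("`JS ∼ B_1 × B_2^p` where `B_1`
and `B_2` are abelian subvarieties of `JS` of dimension `(p−1)/2 (n−2)` and `(q−1)/2 (m−2) + (p−1)/2 (q−1)/p n`", `B_G = 0`).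
[cite: ReyesCarocca2020, Thm. 6 (p. 5)] [cite: KaniRosen1989, Thm. B] -/
theorem dim_image_sub_norm_metacyclic (hp : p.Prime) (hq : q.Prime) (hG : Fintype.card G = p * q)
    (ha : orderOf a = q) (hb : orderOf b = p) (hab : b * a * b⁻¹ = a ^ r) (hr : (r : ZMod q) ^ p = 1)
    (hr1 : (r : ZMod q) ≠ 1) (hN : End.of N = ∑ g, ρ g) (hNA : End.of NA = ∑ h : Subgroup.zpowers a, ρ h)
    (hNB : End.of NB = ∑ h : Subgroup.zpowers b, ρ h) :
    (image (q • 𝟙 X - NA)).dim + p * (image N).dim = p * (image NB).dim := by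
  have e := (isIsogenous_image_sub_norm_metacyclic ρ hp hq hG ha hb hab hr hr1 hN hNA hNB).dim_eq
  simp only [dim_biprod, dim_biproduct_const, Fintype.card_fin] at e
  exact e

end MetacyclicIsogeny

end AbelianVariety

end Literature.AlgebraicGeometry.Motives
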